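import Summits.ResolutionOfSingularities.ResolutionOfSingularities.Theorems.WeightedInvariantIota3RowAAllFlags

/-!
# (F-3f) Row B with class-`0` mixed terms — the ENGINE with an extra summand  [OURS · L1 W4.3]

Kernel infrastructure for RE-ENTRY OBJECT #1 of chain w43 (door crux `stmt-ResolutionOfSingularities-19897`),
rung (F-3f) of res-D-brk-1's Frobenius-class argument (O70B-JCAN-PLAN §7, «ROW B»): the germ
`f = y^p + Λ v^d + g + x^M` with an extra summand `g` (the mixed terms).  The Row-A proof survives verbatim as long as

* (α) `g` has no coefficient at `X₀^{d m₀}`:  `W(g) > d·W(v)`;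
* (β) the non-class-`0` part of `g` weighs more than the leading term `d·R·G^{d−1}`:
  `W(g − g_0) > (d−1)·W(v_0) + W(v − v_0)`;
* (Frobenius) `g` has no coefficient at the exponents `p·e_i`.

This file: `r₂_lt_weightedOrder_rest_add` (the (β) engine with `g`), `coeff_linear_eq_zero_of_reach_add`,
`le_weightedOrder_pow_sub_pClassComponent` (`W(v^b − (v^b)_0) ≥ (b−1)·W(v_0) + W(v − v_0)`), and the frame-free
core `rowB_core_anyFrame` with the three hypotheses on `g` in conditional form.  The concrete Row-B tails
`Σ γ_j x^{c_j} v^{b_j}` (`p ∣ c_j`, `1 ≤ b_j < d`, `q c_j + r₂ b_j = N`) are treated in `…Iota3RowBClassZeroTail`.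

[OURS · L1 W4.3] NOT a statement of the manuscript; AI-produced, gate-checked, weaker than expert review.
-/

set_option linter.dupNamespace false

namespace Summit.ResolutionOfSingularities.ResolutionOfSingularities.Theorems.LocalEngine.Iota3.RowA

open MvPowerSeries IsLocalRing
open Summit.ResolutionOfSingularities.ResolutionOfSingularities.Theorems.LocalEngine.Iota3.PClass
open Summit.ResolutionOfSingularities.ResolutionOfSingularities.Cruxes.HypersurfaceCentreConstruction.LocalEngine.Iota3

variable {K : Type*} [Field K]

/-! ## The (β) engine with an extra summand -/

/-- **THE (β) ENGINE WITH AN EXTRA SUMMAND `g`.**  As `r₂_lt_weightedOrder_rest`, for `h = y^p + Λ v^d + g` with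
`W(h) ≥ N`, provided the non-class-`0` part of `g` weighs more than `(d−1)·q m₀ + W(v − v_0)`. -/
theorem r₂_lt_weightedOrder_rest_add (p : ℕ) [Fact p.Prime] [CharP K p] {d q r₁ r₂ N : ℕ} (hpd : ¬ p ∣ d)
    (hd2 : 2 ≤ d) (hN₂ : d * r₂ = N) (hqr : q < r₂) {Λ : K} (hΛ : Λ ≠ 0) {y v : MvPowerSeries (Fin 3) K}
    {m₀ : ℕ} (hcm : coeff (Finsupp.single 0 m₀) v ≠ 0)
    (hini : ∀ e, coeff e v ≠ 0 → e ≠ Finsupp.single 0 m₀ →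
      Finsupp.weight ![q, r₂, r₁] (Finsupp.single 0 m₀) < Finsupp.weight ![q, r₂, r₁] e)
    (ham : q * m₀ < r₂) (hpm : p ∣ m₀) (g : MvPowerSeries (Fin 3) K)
    (hg : ∀ ρ : ℕ, (v - pClassComponent p 0 v).weightedOrder ![q, r₂, r₁] = ρ → q * m₀ < ρ →
      ((((d - 1) * (q * m₀) + ρ : ℕ)) : ℕ∞) < (g - pClassComponent p 0 g).weightedOrder ![q, r₂, r₁])
    (hWh : (N : ℕ∞) ≤ (y ^ p + C Λ * v ^ d + g).weightedOrder ![q, r₂, r₁]) :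
    (r₂ : ℕ∞) < (v - pClassComponent p 0 v).weightedOrder ![q, r₂, r₁] := by
  classical
  haveI : NeZero p := ⟨(Fact.out : p.Prime).ne_zero⟩
  set G := pClassComponent p 0 v with hGdef
  set R := v - pClassComponent p 0 v with hRdef
  have hclass : exponentClass p (Finsupp.single (0 : Fin 3) m₀) = 0 := by
    rw [exponentClass_eq_zero_iff]
    intro i
    rw [Finsupp.single_apply]
    split_ifs
    · exact hpm
    · exact dvd_zero p
  have hWG : G.weightedOrder ![q, r₂, r₁] = ((q * m₀ : ℕ) : ℕ∞) := by
    have h := weightedOrder_pClassComponent_of_initialMonomial (![q, r₂, r₁]) p hcm hini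
    rw [hclass, weight_single_zero] at h
    exact h
  have hWR : ((q * m₀ : ℕ) : ℕ∞) < R.weightedOrder ![q, r₂, r₁] := by
    have h := weight_lt_weightedOrder_sub_pClassComponent_of_initialMonomial (![q, r₂, r₁]) p hini
    rw [hclass, weight_single_zero] at h
    exact h
  have hG0 : pClassComponent p 0 G = G := by
    rw [hGdef, pClassComponent_pClassComponent, if_pos rfl]
  have hR0 : pClassComponent p 0 R = 0 := pClassComponent_sub_pClassComponent_self p 0 v
  by_contra hρ
  push Not at hρ
  have hRne : R.weightedOrder ![q, r₂, r₁] ≠ ⊤ := ne_top_of_le_ne_top (ENat.coe_ne_top r₂) hρ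
  obtain ⟨ρ, hρeq⟩ : ∃ ρ : ℕ, R.weightedOrder ![q, r₂, r₁] = ρ := ⟨_, (ENat.coe_toNat hRne).symm⟩
  rw [hρeq, Nat.cast_le] at hρ
  rw [hρeq, Nat.cast_lt] at hWR
  -- the non-class-0 part `Q` of `v^d` has `W(Q) ≥ N` (coefficientwise)
  set Q := v ^ d - pClassComponent p 0 (v ^ d) with hQdef
  have hhQ : y ^ p + C Λ * v ^ d + g - pClassComponent p 0 (y ^ p + C Λ * v ^ d + g) =
      C Λ * Q + (g - pClassComponent p 0 g) := by
    rw [pClassComponent_add, pClassComponent_add, pClassComponent_zero_pow_expChar, pClassComponent_C_mul, hQdef]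
    ring
  have hQ : ∀ e : Fin 3 →₀ ℕ, Finsupp.weight ![q, r₂, r₁] e < N →
      (Finsupp.weight ![q, r₂, r₁] e : ℕ∞) < (g - pClassComponent p 0 g).weightedOrder ![q, r₂, r₁] →
      coeff e Q = 0 := by
    intro e he heg
    have h1 : coeff e (C Λ * Q + (g - pClassComponent p 0 g)) = 0 := by
      rw [← hhQ]
      refine coeff_eq_zero_of_lt_weightedOrder _ (lt_of_lt_of_le ?_
        (hWh.trans (le_weightedOrder_sub_pClassComponent _ p 0 _)))
      exact_mod_cast he
    rw [map_add, coeff_C_mul, coeff_eq_zero_of_lt_weightedOrder _ heg, add_zero] at h1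
    exact (mul_eq_zero.mp h1).resolve_left hΛ
  -- binomial expansion of `v^d = (R + G)^d` by classes
  have hGpow : ∀ j, pClassComponent p 0 (G ^ j) = G ^ j := pClassComponent_zero_pow_of_pure p hG0
  have hP : ∀ k, pClassComponent p 0 (G ^ (d - k) * (d.choose k : MvPowerSeries (Fin 3) K)) =
      G ^ (d - k) * (d.choose k : MvPowerSeries (Fin 3) K) := fun k => by
    rw [← map_natCast (C : K →+* MvPowerSeries (Fin 3) K), mul_comm, pClassComponent_C_mul, hGpow]
  have hvRG : v = R + G := by rw [hRdef, hGdef, sub_add_cancel]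
  have hQsum : Q = ∑ k ∈ Finset.range (d + 1),
      (R ^ k - pClassComponent p 0 (R ^ k)) * (G ^ (d - k) * (d.choose k : MvPowerSeries (Fin 3) K)) := by
    rw [hQdef, hvRG, add_pow, pClassComponent_sum, ← Finset.sum_sub_distrib]
    refine Finset.sum_congr rfl fun k _ => ?_
    rw [mul_assoc, pClassComponent_mul_of_right_pure_zero (hP k), sub_mul]
  -- orders of the terms
  have hWd : ((d : ℕ) : MvPowerSeries (Fin 3) K).weightedOrder ![q, r₂, r₁] = 0 := by
    rw [← map_natCast (C : K →+* MvPowerSeries (Fin 3) K)]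
    exact weightedOrder_C _ ((CharP.cast_eq_zero_iff K p d).not.mpr hpd)
  have hT1 : ((R ^ 1 - pClassComponent p 0 (R ^ 1)) * (G ^ (d - 1) * (d.choose 1 : MvPowerSeries (Fin 3) K))).weightedOrder
      ![q, r₂, r₁] = ((ρ + (d - 1) * (q * m₀) : ℕ) : ℕ∞) := by
    rw [pow_one, hR0, sub_zero, Nat.choose_one_right, weightedOrder_mul, weightedOrder_mul, weightedOrder_pow,
      hWG, hWd, hρeq, add_zero, nsmul_eq_mul]
    push_cast
    ring
  have hTk : ∀ k ∈ Finset.range (d + 1), 2 ≤ k →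
      (((ρ + (d - 1) * (q * m₀) : ℕ) : ℕ∞)) <
        ((R ^ k - pClassComponent p 0 (R ^ k)) * (G ^ (d - k) * (d.choose k : MvPowerSeries (Fin 3) K))).weightedOrder
          ![q, r₂, r₁] := by
    intro k hk hk2
    rw [Finset.mem_range] at hk
    have hnum := lt_binomial_weight hk2 (Nat.lt_succ_iff.mp hk) hWR
    refine lt_of_lt_of_le (b := (((k * ρ + (d - k) * (q * m₀) : ℕ) : ℕ∞))) (by exact_mod_cast hnum) ?_
    refine le_trans ?_ (le_weightedOrder_mul _)
    have h1 : (((k * ρ : ℕ)) : ℕ∞) ≤ (R ^ k - pClassComponent p 0 (R ^ k)).weightedOrder ![q, r₂, r₁] := by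
      refine le_trans ?_ (le_weightedOrder_sub_pClassComponent _ p 0 _)
      rw [weightedOrder_pow, hρeq, nsmul_eq_mul, Nat.cast_mul]
    have h2 : ((((d - k) * (q * m₀) : ℕ)) : ℕ∞) ≤
        (G ^ (d - k) * (d.choose k : MvPowerSeries (Fin 3) K)).weightedOrder ![q, r₂, r₁] := by
      refine le_trans ?_ (le_weightedOrder_mul _)
      rw [weightedOrder_pow, hWG, nsmul_eq_mul, Nat.cast_mul]
      exact le_self_add
    push_cast at h1 h2 ⊢
    exact add_le_add h1 h2
  -- the `k = 1` term has a nonzero coefficient of weight `ρ + (d-1)a`, invisible to the other terms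
  have hfin : ((((R ^ 1 - pClassComponent p 0 (R ^ 1)) * (G ^ (d - 1) * (d.choose 1 : MvPowerSeries (Fin 3) K))).weightedOrder
      ![q, r₂, r₁]).toNat : ℕ∞) =
      ((R ^ 1 - pClassComponent p 0 (R ^ 1)) * (G ^ (d - 1) * (d.choose 1 : MvPowerSeries (Fin 3) K))).weightedOrder
        ![q, r₂, r₁] := by
    rw [hT1]; rfl
  obtain ⟨e, hce, hwe⟩ := exists_coeff_ne_zero_and_weightedOrder _ hfin
  rw [hT1, Nat.cast_inj] at hwe
  have hcoeffQ : coeff e Q = coeff e ((R ^ 1 - pClassComponent p 0 (R ^ 1)) *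
      (G ^ (d - 1) * (d.choose 1 : MvPowerSeries (Fin 3) K))) := by
    rw [hQsum, map_sum]
    refine Finset.sum_eq_single 1 (fun k hk hk1 => ?_) (fun h => absurd (Finset.mem_range.mpr (by omega)) h)
    rcases Nat.lt_or_ge k 2 with hk2 | hk2
    · -- k = 0
      have hk0 : k = 0 := by omega
      have h1 : pClassComponent p 0 (1 : MvPowerSeries (Fin 3) K) = 1 := by
        have h := hGpow 0
        rwa [pow_zero] at h
      rw [hk0, pow_zero, h1, sub_self, zero_mul, map_zero]
    · refine coeff_eq_zero_of_lt_weightedOrder (![q, r₂, r₁]) ?_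
      rw [hwe]
      exact hTk k hk hk2
  have hlight : Finsupp.weight ![q, r₂, r₁] e < N := by
    rw [hwe, ← hN₂]
    have h1 : (d - 1) * (q * m₀) ≤ (d - 1) * (r₂ - 1) := Nat.mul_le_mul_left _ (by omega)
    have h2 : ρ + (d - 1) * (r₂ - 1) < d * r₂ := by
      obtain ⟨j, rfl⟩ := Nat.exists_eq_add_of_le hd2
      obtain ⟨i, rfl⟩ := Nat.exists_eq_add_of_le (Nat.one_le_of_lt hqr)
      rw [show 2 + j - 1 = j + 1 by omega, show 1 + i - 1 = i by omega]
      nlinarith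
    omega
  have hlight' : (Finsupp.weight ![q, r₂, r₁] e : ℕ∞) < (g - pClassComponent p 0 g).weightedOrder ![q, r₂, r₁] := by
    rw [hwe, show ρ + (d - 1) * (q * m₀) = (d - 1) * (q * m₀) + ρ from by ring]
    exact hg ρ hρeq hWR
  exact absurd (hcoeffQ ▸ hQ e hlight hlight') hce


/-! ## Frobenius on the linear coefficients, with an extra summand -/

/-- From `W(y^p + Λ v^d + g + x^M) ≥ N > p·w_i` (with `v, x ∈ 𝔪`, `p < d`, `p < M`, `coeff (p e_i) g = 0`),
the `X_i`-coefficient of `y` vanishes. -/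
theorem coeff_linear_eq_zero_of_reach_add (p : ℕ) [Fact p.Prime] [CharP K p] {d M N : ℕ} (hlt : p < d)
    (hpM : p < M) (w : Fin 3 → ℕ) (i : Fin 3) (hi : p * w i < N) {Λ : K} {x y v g : MvPowerSeries (Fin 3) K}
    (hv0 : constantCoeff v = 0) (hx0 : constantCoeff x = 0) (hg : coeff (p • Finsupp.single i 1) g = 0)
    (hreach : (N : ℕ∞) ≤ (y ^ p + C Λ * v ^ d + g + x ^ M).weightedOrder w) :
    coeff (Finsupp.single i 1) y = 0 := by
  classical
  have hw : Finsupp.weight w (p • Finsupp.single i 1) = p * w i := by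
    rw [Finsupp.smul_single, smul_eq_mul, mul_one, Finsupp.weight_single, smul_eq_mul]
  have hz : coeff (p • Finsupp.single i 1) (y ^ p + C Λ * v ^ d + g + x ^ M) = 0 :=
    coeff_eq_zero_of_lt_weightedOrder _ (lt_of_lt_of_le (by rw [hw]; exact_mod_cast hi) hreach)
  rw [map_add, map_add, map_add, coeff_nsmul_pow_expChar, coeff_C_mul,
    coeff_pow_eq_zero_of_degree_lt hv0 (by rw [degree_nsmul_single]; exact hlt), mul_zero, add_zero, hg, add_zero,
    coeff_pow_eq_zero_of_degree_lt hx0 (by rw [degree_nsmul_single]; exact hpM), add_zero] at hz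
  exact pow_eq_zero_iff (Nat.Prime.ne_zero Fact.out) |>.mp hz

/-! ## The non-class-`0` part of a power -/

/-- `W(v^b − (v^b)_0) ≥ (b−1)·W(v_0) + W(v − v_0)` when `W(v_0) ≤ W(v − v_0)` (finitely many variables). -/
theorem le_weightedOrder_pow_sub_pClassComponent (p : ℕ) [NeZero p] (w : Fin 3 → ℕ) (v : MvPowerSeries (Fin 3) K)
    {b : ℕ} (hb : 1 ≤ b)
    (hGR : (pClassComponent p 0 v).weightedOrder w ≤ (v - pClassComponent p 0 v).weightedOrder w) :
    (b - 1) • (pClassComponent p 0 v).weightedOrder w + (v - pClassComponent p 0 v).weightedOrder w ≤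
      (v ^ b - pClassComponent p 0 (v ^ b)).weightedOrder w := by
  classical
  set G := pClassComponent p 0 v with hGdef
  set R := v - pClassComponent p 0 v with hRdef
  have hG0 : pClassComponent p 0 G = G := by rw [hGdef, pClassComponent_pClassComponent, if_pos rfl]
  have hGpow : ∀ j, pClassComponent p 0 (G ^ j) = G ^ j := pClassComponent_zero_pow_of_pure p hG0
  have hP : ∀ k, pClassComponent p 0 (G ^ (b - k) * (b.choose k : MvPowerSeries (Fin 3) K)) =
      G ^ (b - k) * (b.choose k : MvPowerSeries (Fin 3) K) := fun k => by
    rw [← map_natCast (C : K →+* MvPowerSeries (Fin 3) K), mul_comm, pClassComponent_C_mul, hGpow]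
  have hvRG : v = R + G := by rw [hRdef, hGdef, sub_add_cancel]
  have hsum : v ^ b - pClassComponent p 0 (v ^ b) = ∑ k ∈ Finset.range (b + 1),
      (R ^ k - pClassComponent p 0 (R ^ k)) * (G ^ (b - k) * (b.choose k : MvPowerSeries (Fin 3) K)) := by
    rw [hvRG, add_pow, pClassComponent_sum, ← Finset.sum_sub_distrib]
    refine Finset.sum_congr rfl fun k _ => ?_
    rw [mul_assoc, pClassComponent_mul_of_right_pure_zero (hP k), sub_mul]
  have h1 : pClassComponent p 0 (1 : MvPowerSeries (Fin 3) K) = 1 := by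
    have h := hGpow 0
    rwa [pow_zero] at h
  rw [hsum]
  refine le_weightedOrder _ fun e he => ?_
  rw [map_sum]
  refine Finset.sum_eq_zero fun k hk => ?_
  rcases Nat.eq_zero_or_pos k with rfl | hk1
  · rw [pow_zero, h1, sub_self, zero_mul, map_zero]
  · refine coeff_eq_zero_of_lt_weightedOrder _ (lt_of_lt_of_le he ?_)
    rw [Finset.mem_range] at hk
    -- `(b-1)·W G + W R ≤ k·W R + (b-k)·W G ≤ W (term k)`
    refine le_trans ?_ (le_weightedOrder_mul _)
    have hR : k • R.weightedOrder w ≤ (R ^ k - pClassComponent p 0 (R ^ k)).weightedOrder w :=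
      le_trans (le_weightedOrder_pow _ k) (le_weightedOrder_sub_pClassComponent _ p 0 _)
    have hG : (b - k) • G.weightedOrder w ≤ (G ^ (b - k) * (b.choose k : MvPowerSeries (Fin 3) K)).weightedOrder w :=
      le_trans (le_weightedOrder_pow _ (b - k)) (le_trans le_self_add (le_weightedOrder_mul _))
    refine le_trans ?_ (add_le_add hR hG)
    obtain ⟨k', rfl⟩ := Nat.exists_eq_add_of_le hk1
    have hsplit : (b - 1) • G.weightedOrder w = k' • G.weightedOrder w + (b - (1 + k')) • G.weightedOrder w := by
      rw [← add_nsmul]; congr 1; omega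
    rw [hsplit, add_nsmul, one_nsmul]
    calc k' • G.weightedOrder w + (b - (1 + k')) • G.weightedOrder w + R.weightedOrder w
        = k' • G.weightedOrder w + R.weightedOrder w + (b - (1 + k')) • G.weightedOrder w := by ring
      _ ≤ k' • R.weightedOrder w + R.weightedOrder w + (b - (1 + k')) • G.weightedOrder w := by
          gcongr
      _ = R.weightedOrder w + k' • R.weightedOrder w + (b - (1 + k')) • G.weightedOrder w := by ring

/-! ## The core with an extra summand, arbitrary frame -/

/-- **ROW B (class-`0` tails), CORE FORM, ARBITRARY FRAME.**  As `rowA_core_anyFrame` for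
`f = y^p + Λ v^d + g + x^M`, with the three hypotheses on `g` in conditional form (`a = W(v) < r₂`):
no coefficients at `p·e_i`; `W(g) > d·a`; `W(g − g_0) > (d−1)a + ρ` whenever `W(v_0) = a < ρ = W(v − v_0)`. -/
theorem rowB_core_anyFrame (p : ℕ) [Fact p.Prime] [CharP K p] {d M q r₁ r₂ N : ℕ} (hpd : ¬ p ∣ d) (hlt : p < d)
    (hN₁ : p * r₁ = N) (hN₂ : d * r₂ = N) (hN₃ : M * q = N) (hq : 0 < q) (hqr : q < r₂) {Λ : K} (hΛ : Λ ≠ 0)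
    {x y v g : MvPowerSeries (Fin 3) K} (hx0 : constantCoeff x = 0) (hv0 : constantCoeff v = 0)
    (hy0 : constantCoeff y = 0)
    (hX0 : (X 0 : MvPowerSeries (Fin 3) K) ∈ Ideal.span {x, v, y})
    (hX1 : (X 1 : MvPowerSeries (Fin 3) K) ∈ Ideal.span {x, v, y})
    (hgp : ∀ i : Fin 3, coeff (p • Finsupp.single i 1) g = 0)
    (hgα : ∀ a : ℕ, v.weightedOrder ![q, r₂, r₁] = (a : ℕ∞) → a < r₂ →
      (((d * a : ℕ)) : ℕ∞) < g.weightedOrder ![q, r₂, r₁])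
    (hgβ : ∀ a ρ : ℕ, (pClassComponent p 0 v).weightedOrder ![q, r₂, r₁] = (a : ℕ∞) →
      (v - pClassComponent p 0 v).weightedOrder ![q, r₂, r₁] = (ρ : ℕ∞) → a < r₂ → a < ρ →
      ((((d - 1) * a + ρ : ℕ)) : ℕ∞) < (g - pClassComponent p 0 g).weightedOrder ![q, r₂, r₁])
    (hreach : (N : ℕ∞) ≤ (y ^ p + C Λ * v ^ d + g + x ^ M).weightedOrder ![q, r₂, r₁]) :
    (r₂ : ℕ∞) ≤ v.weightedOrder ![q, r₂, r₁] := by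
  classical
  -- numerics
  have hp : p.Prime := Fact.out
  have hp2 : 2 ≤ p := hp.two_le
  have hd2 : 2 ≤ d := by omega
  have hr₂ : 0 < r₂ := by omega
  have hr₂r₁ : r₂ < r₁ := by
    by_contra h
    push Not at h
    have h1 : p * r₁ ≤ p * r₂ := Nat.mul_le_mul_left _ h
    have h2 : p * r₂ < d * r₂ := Nat.mul_lt_mul_of_pos_right hlt hr₂
    omega
  have hpr₂N : p * r₂ < N := by
    have := Nat.mul_lt_mul_of_pos_left hr₂r₁ hp.pos
    omega
  have hpM : p < M := by
    by_contra h
    push Not at h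
    have h1 : M * q ≤ p * q := Nat.mul_le_mul_right _ h
    have h2 : p * q < p * r₁ := Nat.mul_lt_mul_of_pos_left (hqr.trans hr₂r₁) hp.pos
    omega
  have hpqN : p * q < N := by
    have := Nat.mul_lt_mul_of_pos_right hpM hq
    omega
  haveI : NeZero p := ⟨hp.ne_zero⟩
  haveI : Fact (1 < p) := ⟨hp.one_lt⟩
  -- `x^M` and `h = y^p + Λ v^d + g` weigh at least `N`
  have hWxM : (N : ℕ∞) ≤ (x ^ M).weightedOrder ![q, r₂, r₁] :=
    le_weightedOrder_pow_of_constantCoeff_eq_zero hqr.le hr₂r₁.le hN₃ hx0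
  have hWh : (N : ℕ∞) ≤ (y ^ p + C Λ * v ^ d + g).weightedOrder ![q, r₂, r₁] := by
    have hX : (N : ℕ∞) ≤ (-(x ^ M)).weightedOrder ![q, r₂, r₁] := by rwa [weightedOrder_neg]
    have h := min_weightedOrder_le_add (w := ![q, r₂, r₁]) (f := y ^ p + C Λ * v ^ d + g + x ^ M) (g := -(x ^ M))
    rw [add_neg_cancel_right] at h
    exact le_trans (le_min hreach hX) h
  by_contra hvlt
  push Not at hvlt
  -- the initial form of `v` is `μ X₀^{m₀}`, `q m₀ < r₂`
  obtain ⟨m₀, hcm, hWv, ham, hini⟩ := initialMonomial_of_weightedOrder_lt hq hr₂r₁.le hvlt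
  have hm₀ : 0 < m₀ := by
    by_contra h0
    have h0 : m₀ = 0 := by omega
    rw [h0, Finsupp.single_zero, coeff_zero_eq_constantCoeff_apply, hv0] at hcm
    exact hcm rfl
  -- `y` has neither `X₀`- nor `X₁`-term
  have hy₀ : coeff (Finsupp.single 0 1) y = 0 :=
    coeff_linear_eq_zero_of_reach_add p hlt hpM _ 0 (show p * q < N from hpqN) hv0 hx0 (hgp 0) hreach
  have hy₁ : coeff (Finsupp.single 1 1) y = 0 :=
    coeff_linear_eq_zero_of_reach_add p hlt hpM _ 1 (show p * r₂ < N from hpr₂N) hv0 hx0 (hgp 1) hreach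
  by_cases hpm : p ∣ m₀
  · /- CASE (β) -/
    have hclass : exponentClass p (Finsupp.single (0 : Fin 3) m₀) = 0 := by
      rw [exponentClass_eq_zero_iff]
      intro i
      rw [Finsupp.single_apply]
      split_ifs
      · exact hpm
      · exact dvd_zero p
    have hWG : (pClassComponent p 0 v).weightedOrder ![q, r₂, r₁] = ((q * m₀ : ℕ) : ℕ∞) := by
      have h := weightedOrder_pClassComponent_of_initialMonomial (![q, r₂, r₁]) p hcm hini
      rw [hclass, weight_single_zero] at h
      exact h
    have hR := r₂_lt_weightedOrder_rest_add p hpd hd2 hN₂ hqr hΛ hcm hini ham hpm g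
      (fun ρ hρ hlt' => hgβ (q * m₀) ρ hWG hρ ham hlt') hWh
    have hR₁ : coeff (Finsupp.single 1 1) (v - pClassComponent p 0 v) = 0 :=
      coeff_eq_zero_of_lt_weightedOrder (![q, r₂, r₁]) (by rwa [weight_single_one])
    have hR₀ : coeff (Finsupp.single 0 1) (v - pClassComponent p 0 v) = 0 := by
      refine coeff_eq_zero_of_lt_weightedOrder (![q, r₂, r₁]) (lt_trans ?_ hR)
      rw [weight_single_zero, mul_one, Nat.cast_lt]
      exact hqr
    have hcl : ∀ i : Fin 3, exponentClass p (Finsupp.single i 1) ≠ 0 := fun i h => by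
      have h1 := congr_fun h i
      rw [exponentClass_apply, Finsupp.single_eq_same, Nat.cast_one, Pi.zero_apply] at h1
      exact one_ne_zero h1
    have hG₀ : coeff (Finsupp.single 0 1) (pClassComponent p 0 v) = 0 := coeff_pClassComponent_of_ne (hcl 0) v
    have hG₁ : coeff (Finsupp.single 1 1) (pClassComponent p 0 v) = 0 := coeff_pClassComponent_of_ne (hcl 1) v
    have hsplit : v = (v - pClassComponent p 0 v) + pClassComponent p 0 v := (sub_add_cancel v _).symm
    have hv₀ : coeff (Finsupp.single 0 1) v = 0 := by rw [hsplit, map_add, hR₀, hG₀, add_zero]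
    have hv₁ : coeff (Finsupp.single 1 1) v = 0 := by rw [hsplit, map_add, hR₁, hG₁, add_zero]
    exact false_of_frame₂ hX0 hX1 hx0 hv0 hy0 hv₀ hv₁ hy₀ hy₁
  · /- CASE (α) -/
    have hdm : ¬ p ∣ d * m₀ := fun h => (hp.dvd_mul.mp h).elim hpd hpm
    have hwt : Finsupp.weight ![q, r₂, r₁] (Finsupp.single 0 (d * m₀)) < N := by
      rw [weight_single_zero, ← hN₂]
      nlinarith
    have hwg : (Finsupp.weight ![q, r₂, r₁] (Finsupp.single 0 (d * m₀)) : ℕ∞) < g.weightedOrder ![q, r₂, r₁] := by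
      rw [weight_single_zero, show q * (d * m₀) = d * (q * m₀) by ring]
      exact hgα (q * m₀) hWv ham
    have hz : coeff (Finsupp.single 0 (d * m₀)) (y ^ p + C Λ * v ^ d + g + x ^ M) = 0 :=
      coeff_eq_zero_of_lt_weightedOrder _ (lt_of_lt_of_le (by exact_mod_cast hwt) hreach)
    rw [map_add, map_add, map_add, coeff_pow_expChar_eq_zero p y (i := 0) (by rwa [Finsupp.single_eq_same]), zero_add,
      coeff_C_mul, coeff_eq_zero_of_lt_weightedOrder _ hwg, add_zero,
      coeff_eq_zero_of_lt_weightedOrder _ (lt_of_lt_of_le (by exact_mod_cast hwt) hWxM), add_zero] at hz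
    exact (mul_ne_zero hΛ (coeff_single_pow_ne_zero hcm hini (by omega))) hz

end Summit.ResolutionOfSingularities.ResolutionOfSingularities.Theorems.LocalEngine.Iota3.RowA
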